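import Summits.BirchSwinnertonDyer.BirchSwinnertonDyer.Theorems.GenusKolyvaginAtTwoMultiGenusPrimitivityAtTwoAuxiliaryField
import Summits.BirchSwinnertonDyer.Rank1Residual.AdditivePotMult.TwistPointsOver
import Literature.NumberTheory.EllipticCurves.HeegnerPointsGaloisDescent
import Literature.NumberTheory.EllipticCurves.MordellWeilRankZeroProofs
import Literature.NumberTheory.QuadraticFields.SquareRootGenerator
import Literature.NumberTheory.QuadraticFields.ThreeTorsion

/-!
# Route `GenusKolyvaginAtTwo`, crux stmt-BirchSwinnertonDyer-24947 `MultiGenusPrimitivityAtTwo` (U): the auxiliary-field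
# certificate with the rank hypothesis DISCHARGED ONTO THE EVEN GENUS TWIST `E^{(ℓ*·d_K)}`

Lead prover seat bsd-line-gk2-p1 (g6); sequel to `…AuxiliaryField` (p611810), whose certificate-in-the-auxiliary-field theorem
carried the displayed hypothesis `hR0` («the `τ`-FIXED `χ_ℓ`-isotypic points of `E(K[ℓ])` are torsion»). Here those points are
identified: with `√d ∈ K ∖ ℚ` (`Quadratic.exists_not_mem_range_sq_eq_discr`) and `u = θ_ℓ·√d` (`u² = ℓ*·d ∉ ℚ²`), every
automorphism of `K[ℓ]` acts on such a point by the sign it has on `u` (§1–§2: `τ√d = −√d` for EVERY `τ ∉ Gal(K[ℓ]/K)` since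
`K = ℚ + ℚ√d`, tree `Quadratic.exists_eq_add_mul`); so by the twist substitution over `K[ℓ]` (cell `b2b-bsdres`,
`AdditivePotMult.twistPointEquivOver` + (anti-)naturality) and Galois descent along the Galois extension `K[ℓ]/ℚ`
(`exists_map_eq_of_forall_map_galois_eq`, `X11b.RingClassConj.isGalois_rat_ringClassField`) it IS the transport of a
`ℚ`-RATIONAL point of the EVEN genus twist `E^{(ℓ*·d)}` (`heegner_conjFixed_isotypic_eq_twistPoint`). Hence `hR0` follows from
«`E^{(ℓ*·d)}(ℚ)` finite» (pigeonhole on the multiples `k·S`), i.e. from `#Sel₂ = 1` for any elliptic model of that twist (descent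
count + Mordell–Weil, `finite_point_of_rank_zero`). NET (§3, no auxiliary `τ` left): **on the crux's frame at a depth-2 Kolyvagin
prime `ℓ` whose even genus twist has `#Sel₂ = 1` (the LEVEL LAW's minimal pair, rank-0 side), the certificate
`Σ_{g∈T} g·y(ℓ) ∉ 2E(K[ℓ])` holds iff no odd multiple of `W_ℓ` is twice a `ℚ(θ_ℓ)`-rational point of `E(K[ℓ])`.** Helper
(`--supports stmt-BirchSwinnertonDyer-24947`); no named fact; BSD is not proved by any of this.

References: [SilvermanAEC2009] X.2 Prop. 2.4, X.5 Cor. 5.4, VIII.6.7, X.4.2; [Cox2013] §9.A Lemma 9.3; [GrossLMS1991] §3–§5;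
[Dokchitser2013ParityNotes] §4.
-/

set_option linter.dupNamespace false -- tree convention: `Summit.BirchSwinnertonDyer.BirchSwinnertonDyer.Theorems` (summit = sub-problem)

noncomputable section

open scoped Classical

namespace Summit.BirchSwinnertonDyer.BirchSwinnertonDyer.Theorems.GenusKoly

open Finset NumberField WeierstrassCurve Literature.NumberTheory.EllipticCurves
  Literature.NumberTheory.EllipticCurves.ModularForms
  Literature.NumberTheory.QuadraticFields
  Summit.BirchSwinnertonDyer.Rank1Residual.AdditivePotMult
  Summit.BirchSwinnertonDyer.Rank1Residual.X11b.RingClassConj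

section Heegner

variable {W : WeierstrassCurve ℚ} [NeZero (W.conductorNorm ℤ)] {K : Type} [Field K] [NumberField K]
  {Dt : ModularParametrizationData W (W.conductorNorm ℤ)} {β : ℤ} {ι : K →+* ℂ}

/-! ### §1 The square root `δ = √d_K ∈ K ⊂ K[n]` and the element `u = θ_ℓ · δ` -/

/-- `K → K[n] →` agrees with `ℚ → K[n]` on rationals. [folklore] -/
theorem algebraMap_algebraMap_rat {n : ℕ} (q : ℚ) :
    algebraMap K (ringClassField K ι n) (algebraMap ℚ K q) = algebraMap ℚ (ringClassField K ι n) q := by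
  rw [← RingHom.comp_apply, eq_ratCast, eq_ratCast]

/-- **Every automorphism of `K[n]` outside `Gal(K[n]/K)` negates `√d` for a generator `√d` of `K`** (`K = ℚ + ℚ√d`,
tree `Quadratic.exists_eq_add_mul`; an automorphism fixing `√d` fixes `K` pointwise, i.e. lies in `Gal(K[n]/K)`).
[cite: Cox2013, §9.A Lemma 9.3] -/
theorem heegner_apply_sqrt_eq_neg_of_not_mem (hK : IsImaginaryQuadratic K) {n : ℕ}
    {s₀ : K} (hs₀ : s₀ ∉ Set.range (algebraMap ℚ K)) {dK : ℚ} (hs₀2 : s₀ ^ 2 = algebraMap ℚ K dK)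
    {σ : ringClassField K ι n ≃ₐ[ℚ] ringClassField K ι n} (hσ : σ ∉ ringClassGal ι n) :
    σ (algebraMap K (ringClassField K ι n) s₀) = -algebraMap K (ringClassField K ι n) s₀ := by
  have hδ2 : (algebraMap K (ringClassField K ι n) s₀) ^ 2 = algebraMap ℚ (ringClassField K ι n) dK := by
    rw [← map_pow, hs₀2, algebraMap_algebraMap_rat]
  rcases algEquiv_apply_eq_or_eq_neg_of_sq_eq hδ2 σ with h | h
  · exfalso
    refine hσ ((mem_ringClassGal_iff_forall_apply_algebraMap ι n σ).mpr fun k ↦ ?_)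
    obtain ⟨a, b, rfl⟩ := Quadratic.exists_eq_add_mul hK.1 hs₀ k
    rw [map_add, map_mul, algebraMap_algebraMap_rat, algebraMap_algebraMap_rat, map_add, map_mul,
      AlgEquiv.commutes, AlgEquiv.commutes, h]
  · exact h

/-- `u = θ_ℓ · √d` squares to `ℓ* · d`. [folklore] -/
theorem heegner_theta_mul_sqrt_sq {n : ℕ} {θ : ℕ → ringClassField K ι n}
    (hθ : ∀ ℓ' ∈ n.primeFactors, θ ℓ' ^ 2 = algebraMap ℚ (ringClassField K ι n) ((-1 : ℚ) ^ (ℓ' / 2) * ℓ'))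
    {ℓ : ℕ} (hℓ : ℓ ∈ n.primeFactors)
    {s₀ : K} {dK : ℚ} (hs₀2 : s₀ ^ 2 = algebraMap ℚ K dK) :
    (θ ℓ * algebraMap K (ringClassField K ι n) s₀) ^ 2 =
      algebraMap ℚ (ringClassField K ι n) (((-1 : ℚ) ^ (ℓ / 2) * ℓ) * dK) := by
  rw [mul_pow, hθ ℓ hℓ, ← map_pow, hs₀2, algebraMap_algebraMap_rat, ← map_mul]

/-- `u = θ_ℓ · √d ∉ ℚ` on the crux's frame (`σ_ℓ` fixes `√d ∈ K` and negates `θ_ℓ`, so `σ_ℓ u = −u ≠ u`).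
[cite: GrossLMS1991, §3 (G_ℓ, σ_ℓ)] -/
theorem heegner_theta_mul_sqrt_not_mem_range [W.IsGloballyMinimal] (hK : IsImaginaryQuadratic K)
    {ℓ : ℕ} (hℓ : ℓ.Prime) (hKoly : ∀ ℓ' ∈ ℓ.primeFactors, Zhang2014.IsKolyvaginPrime (W.conductorNorm ℤ) W K 2 ℓ')
    (d : KolyvaginHeegnerData Dt β ι ℓ) {θ : ℕ → ringClassField K ι ℓ}
    (hθ : ∀ ℓ' ∈ ℓ.primeFactors, θ ℓ' ^ 2 = algebraMap ℚ (ringClassField K ι ℓ) ((-1 : ℚ) ^ (ℓ' / 2) * ℓ'))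
    {s₀ : K} (hs₀ : s₀ ∉ Set.range (algebraMap ℚ K)) :
    θ ℓ * algebraMap K (ringClassField K ι ℓ) s₀ ∉ Set.range (algebraMap ℚ (ringClassField K ι ℓ)) := by
  have hℓmem : ℓ ∈ ℓ.primeFactors := by rw [Nat.Prime.primeFactors hℓ]; exact Finset.mem_singleton_self ℓ
  obtain ⟨hθ0, hσ, -⟩ := heegner_genusRadicals_table hK (Irreducible.squarefree hℓ) hKoly d hθ ℓ hℓmem
  have hσmem : d.σ ℓ ∈ ringClassGal ι ℓ := by
    have := heegner_sigma_pow_mem hℓ d 1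
    rw [pow_one] at this
    exact ringClassGalOver_le_ringClassGal ι ℓ 1 this
  have hs0 : algebraMap K (ringClassField K ι ℓ) s₀ ≠ 0 := by
    rw [map_ne_zero]
    rintro rfl
    exact hs₀ ⟨0, by simp⟩
  rintro ⟨q, hq⟩
  have hfix : d.σ ℓ (θ ℓ * algebraMap K (ringClassField K ι ℓ) s₀) = θ ℓ * algebraMap K (ringClassField K ι ℓ) s₀ := by
    rw [← hq, AlgEquiv.commutes]
  rw [map_mul, hσ, smul_algebraMap_of_mem_ringClassGal hσmem s₀, neg_mul] at hfix
  exact ne_neg_of_ne_zero (mul_ne_zero hθ0 hs0) hfix.symm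

end Heegner

/-! ### §2 `τ`-fixed isotypic points are rational points of the even twist `E^{(ℓ*·d_K)}` -/

section Descent

-- Point groups over `K[ℓ]` depend on a `DecidableEq K[ℓ]` instance. The twist substitution of cell `b2b-bsdres`
-- (`twistPointEquivOver`) lives in the classical world; the statements below take the instance as a binder `hdec` (so that
-- they instantiate in the world of `…ReducedGenusPoint` / `…AuxiliaryField`) and the proofs specialise it first
-- (a subsingleton, then re-installed as a `letI`) — cf. the device of `…GoldfeldAllTwistsTwoConverseTwinAdditiveGenusDescent` §2.

variable {W : WeierstrassCurve ℚ} {K : Type} [Field K] [NumberField K] {ι : K →+* ℂ}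


/-- **SIGN DICTIONARY.** On `K[ℓ]` with `τ ∉ Gal(K[ℓ]/K)`, `τθ_ℓ = −θ_ℓ`, `√d ∈ K ∖ ℚ` and `u = θ_ℓ·√d`: a `χ_ℓ`-isotypic point
`S` FIXED by `τ` satisfies `σS = S` if `σu = u` and `σS = −S` if `σu ≠ u`, for every `σ ∈ Aut(K[ℓ]/ℚ)`.
[cite: Cox2013, §9.A Lemma 9.3] [cite: SilvermanAEC2009, X.2 Prop. 2.4 (proof)] -/
theorem heegner_conjFixed_isotypic_sign_dictionary {ℓ : ℕ} [hdec : DecidableEq (ringClassField K ι ℓ)]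
    (hK : IsImaginaryQuadratic K) (hℓ : ℓ.Prime)
    {θ : ℕ → ringClassField K ι ℓ}
    (hθ : ∀ ℓ' ∈ ℓ.primeFactors, θ ℓ' ^ 2 = algebraMap ℚ (ringClassField K ι ℓ) ((-1 : ℚ) ^ (ℓ' / 2) * ℓ'))
    {s₀ : K} (hs₀ : s₀ ∉ Set.range (algebraMap ℚ K)) {dK : ℚ} (hs₀2 : s₀ ^ 2 = algebraMap ℚ K dK)
    {τ : ringClassField K ι ℓ ≃ₐ[ℚ] ringClassField K ι ℓ} (hτ : τ ∉ ringClassGal ι ℓ) (hτθ : τ (θ ℓ) = -θ ℓ)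
    {S : (W.baseChange (ringClassField K ι ℓ)).toAffine.Point}
    (hS : ∀ h ∈ ringClassGal ι ℓ, pointGalHom W (ringClassField K ι ℓ) h S =
      (∏ ℓ' ∈ ℓ.primeFactors, (if h (θ ℓ') = θ ℓ' then (1 : ℤ) else -1)) • S)
    (hSτ : pointGalHom W (ringClassField K ι ℓ) τ S = S)
    (σ : ringClassField K ι ℓ ≃ₐ[ℚ] ringClassField K ι ℓ) :
    (σ (θ ℓ * algebraMap K (ringClassField K ι ℓ) s₀) = θ ℓ * algebraMap K (ringClassField K ι ℓ) s₀ →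
        pointGalHom W (ringClassField K ι ℓ) σ S = S) ∧
      (σ (θ ℓ * algebraMap K (ringClassField K ι ℓ) s₀) ≠ θ ℓ * algebraMap K (ringClassField K ι ℓ) s₀ →
        pointGalHom W (ringClassField K ι ℓ) σ S = -S) := by
  set δ := algebraMap K (ringClassField K ι ℓ) s₀ with hδ
  have hmul : ∀ (g h : ringClassField K ι ℓ ≃ₐ[ℚ] ringClassField K ι ℓ)
      (P : (W.baseChange (ringClassField K ι ℓ)).toAffine.Point),
      pointGalHom W (ringClassField K ι ℓ) (g * h) P =
        pointGalHom W (ringClassField K ι ℓ) g (pointGalHom W (ringClassField K ι ℓ) h P) := fun g h P ↦ by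
    rw [map_mul]; rfl
  have hPF : ℓ.primeFactors = {ℓ} := Nat.Prime.primeFactors hℓ
  have hℓmem : ℓ ∈ ℓ.primeFactors := by rw [hPF]; exact Finset.mem_singleton_self ℓ
  have hθ0 : θ ℓ ≠ 0 := ne_zero_of_sq_eq_pStar hℓ (hθ ℓ hℓmem)
  have hs0 : δ ≠ 0 := by
    rw [hδ, map_ne_zero]
    rintro rfl
    exact hs₀ ⟨0, by simp⟩
  have hu0 : θ ℓ * δ ≠ 0 := mul_ne_zero hθ0 hs0
  have hune : -(θ ℓ * δ) ≠ θ ℓ * δ := fun h ↦ ne_neg_of_ne_zero hu0 h.symm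
  by_cases hσm : σ ∈ ringClassGal ι ℓ
  · have hσδ : σ δ = δ := smul_algebraMap_of_mem_ringClassGal hσm s₀
    have hσS := hS σ hσm
    rw [hPF, Finset.prod_singleton] at hσS
    rcases algEquiv_apply_eq_or_eq_neg_of_sq_eq (hθ ℓ hℓmem) σ with h | h
    · rw [if_pos h, one_smul] at hσS
      refine ⟨fun _ ↦ hσS, fun hne ↦ absurd ?_ hne⟩
      rw [map_mul, h, hσδ]
    · have hne' : ¬ σ (θ ℓ) = θ ℓ := by rw [h]; exact fun h' ↦ ne_neg_of_ne_zero hθ0 h'.symm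
      rw [if_neg hne', neg_one_smul] at hσS
      refine ⟨fun heq ↦ absurd heq ?_, fun _ ↦ hσS⟩
      rw [map_mul, h, hσδ, neg_mul]
      exact hune
  · have hσδ : σ δ = -δ := heegner_apply_sqrt_eq_neg_of_not_mem hK hs₀ hs₀2 hσm
    have hh : τ⁻¹ * σ ∈ ringClassGal ι ℓ := inv_mul_mem_ringClassGal_of_not_mem hK ι ℓ hτ hσm
    have hσeq : σ = τ * (τ⁻¹ * σ) := (mul_inv_cancel_left τ σ).symm
    have hhS := hS _ hh
    rw [hPF, Finset.prod_singleton] at hhS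
    rcases algEquiv_apply_eq_or_eq_neg_of_sq_eq (hθ ℓ hℓmem) (τ⁻¹ * σ) with h | h
    · rw [if_pos h, one_smul] at hhS -- `h θ = θ`: `σθ = −θ`, `σu = u`, `σS = S`
      have hσθ : σ (θ ℓ) = -θ ℓ := by
        calc σ (θ ℓ) = (τ * (τ⁻¹ * σ)) (θ ℓ) := by rw [mul_inv_cancel_left]
          _ = -θ ℓ := by rw [AlgEquiv.mul_apply, h, hτθ]
      have hσS : pointGalHom W (ringClassField K ι ℓ) σ S = S := by
        calc pointGalHom W (ringClassField K ι ℓ) σ S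
            = pointGalHom W (ringClassField K ι ℓ) (τ * (τ⁻¹ * σ)) S := by rw [mul_inv_cancel_left]
          _ = S := by rw [hmul, hhS, hSτ]
      refine ⟨fun _ ↦ hσS, fun hne ↦ absurd ?_ hne⟩
      rw [map_mul, hσθ, hσδ, neg_mul_neg]
    · have hne' : ¬ (τ⁻¹ * σ) (θ ℓ) = θ ℓ := by rw [h]; exact fun h' ↦ ne_neg_of_ne_zero hθ0 h'.symm
      rw [if_neg hne', neg_one_smul] at hhS
      have hσθ : σ (θ ℓ) = θ ℓ := by
        calc σ (θ ℓ) = (τ * (τ⁻¹ * σ)) (θ ℓ) := by rw [mul_inv_cancel_left]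
          _ = θ ℓ := by rw [AlgEquiv.mul_apply, h, map_neg, hτθ, neg_neg]
      have hσS : pointGalHom W (ringClassField K ι ℓ) σ S = -S := by
        calc pointGalHom W (ringClassField K ι ℓ) σ S
            = pointGalHom W (ringClassField K ι ℓ) (τ * (τ⁻¹ * σ)) S := by rw [mul_inv_cancel_left]
          _ = -S := by rw [hmul, hhS, map_neg, hSτ]
      refine ⟨fun heq ↦ absurd heq ?_, fun _ ↦ hσS⟩
      rw [map_mul, hσθ, hσδ, mul_neg]
      exact hune

/-- **A `τ`-FIXED `χ_ℓ`-ISOTYPIC POINT IS A RATIONAL POINT OF THE EVEN TWIST `E^{(ℓ*·d)}`**: with `u = θ_ℓ·√d` (`√d ∈ K ∖ ℚ`,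
`u² = ℓ*·d`, `u ∉ ℚ`), `S = Φ_u(ι z)` for some `z ∈ W^{(ℓ*·d)}(ℚ)`, `Φ_u` the twist substitution over `K[ℓ]` and `ι` the base change
of `ℚ`-points (sign dictionary + (anti-)naturality of `Φ_u` + Galois descent along the Galois extension `K[ℓ]/ℚ`).
[cite: SilvermanAEC2009, X.2 Prop. 2.4, X.5 Cor. 5.4, I.§1] [cite: Cox2013, §9.A Lemma 9.3] -/
theorem heegner_conjFixed_isotypic_eq_twistPoint {ℓ : ℕ} [hdec : DecidableEq (ringClassField K ι ℓ)]
    (hK : IsImaginaryQuadratic K) (hℓ : ℓ.Prime)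
    {θ : ℕ → ringClassField K ι ℓ}
    (hθ : ∀ ℓ' ∈ ℓ.primeFactors, θ ℓ' ^ 2 = algebraMap ℚ (ringClassField K ι ℓ) ((-1 : ℚ) ^ (ℓ' / 2) * ℓ'))
    {s₀ : K} (hs₀ : s₀ ∉ Set.range (algebraMap ℚ K)) {dK : ℚ} (hs₀2 : s₀ ^ 2 = algebraMap ℚ K dK)
    (huQ : θ ℓ * algebraMap K (ringClassField K ι ℓ) s₀ ∉ Set.range (algebraMap ℚ (ringClassField K ι ℓ)))
    (hu : (θ ℓ * algebraMap K (ringClassField K ι ℓ) s₀) ^ 2 =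
      algebraMap ℚ (ringClassField K ι ℓ) (((-1 : ℚ) ^ (ℓ / 2) * ℓ) * dK))
    {τ : ringClassField K ι ℓ ≃ₐ[ℚ] ringClassField K ι ℓ} (hτ : τ ∉ ringClassGal ι ℓ) (hτθ : τ (θ ℓ) = -θ ℓ)
    {S : (W.baseChange (ringClassField K ι ℓ)).toAffine.Point}
    (hS : ∀ h ∈ ringClassGal ι ℓ, pointGalHom W (ringClassField K ι ℓ) h S =
      (∏ ℓ' ∈ ℓ.primeFactors, (if h (θ ℓ') = θ ℓ' then (1 : ℤ) else -1)) • S)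
    (hSτ : pointGalHom W (ringClassField K ι ℓ) τ S = S) :
    ∃ z : (W.quadraticTwist (((-1 : ℚ) ^ (ℓ / 2) * ℓ) * dK)).toAffine.Point,
      twistPointEquivOver W huQ hu
        (QuadraticDescent.incl (ringClassField K ι ℓ : Type)
          (W.quadraticTwist (((-1 : ℚ) ^ (ℓ / 2) * ℓ) * dK)) z) = S := by
  have hworld : hdec = fun a b ↦ Classical.propDecidable (a = b) := Subsingleton.elim _ _
  subst hworld
  letI hcl : DecidableEq (ringClassField K ι ℓ) := fun a b ↦ Classical.propDecidable (a = b)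
  haveI := (finiteDimensional_and_isGalois_ringClassField hK ι hℓ.ne_zero).1
  haveI : FiniteDimensional ℚ (ringClassField K ι ℓ) := Module.Finite.trans K _
  haveI : IsGalois ℚ (ringClassField K ι ℓ) := isGalois_rat_ringClassField hK ι hℓ.ne_zero
  have hdict := heegner_conjFixed_isotypic_sign_dictionary hK hℓ hθ hs₀ hs₀2 hτ hτθ hS hSτ
  have hu0 : θ ℓ * algebraMap K (ringClassField K ι ℓ) s₀ ≠ 0 := by
    intro h0
    exact huQ ⟨0, by rw [map_zero, h0]⟩
  have hΦR : twistPointEquivOver W huQ hu ((twistPointEquivOver W huQ hu).symm S) = S :=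
    (twistPointEquivOver W huQ hu).apply_symm_apply S
  have hfix : ∀ σ : ringClassField K ι ℓ ≃ₐ[ℚ] ringClassField K ι ℓ,
      Affine.Point.map (W' := W.quadraticTwist (((-1 : ℚ) ^ (ℓ / 2) * ℓ) * dK))
          (σ : ringClassField K ι ℓ →ₐ[ℚ] ringClassField K ι ℓ) ((twistPointEquivOver W huQ hu).symm S) =
        (twistPointEquivOver W huQ hu).symm S := by
    intro σ
    rcases algEquiv_apply_eq_or_eq_neg_of_sq_eq hu σ with h | h
    · have hSσ := (hdict σ).1 h
      rw [pointGalHom_apply, ← hΦR, map_twistPointEquivOver W huQ hu huQ hu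
        (σ : ringClassField K ι ℓ →ₐ[ℚ] ringClassField K ι ℓ) h _] at hSσ
      exact (twistPointEquivOver W huQ hu).injective hSσ
    · have h' : σ (θ ℓ * algebraMap K (ringClassField K ι ℓ) s₀) ≠ θ ℓ * algebraMap K (ringClassField K ι ℓ) s₀ := by
        rw [h]; exact fun h'' ↦ ne_neg_of_ne_zero hu0 h''.symm
      have hSσ := (hdict σ).2 h'
      rw [pointGalHom_apply, ← hΦR, map_twistPointEquivOver_of_neg W huQ hu huQ hu
        (σ : ringClassField K ι ℓ →ₐ[ℚ] ringClassField K ι ℓ) h _, neg_inj] at hSσ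
      exact (twistPointEquivOver W huQ hu).injective hSσ
  obtain ⟨z, hz⟩ := exists_map_eq_of_forall_map_galois_eq (W.quadraticTwist (((-1 : ℚ) ^ (ℓ / 2) * ℓ) * dK))
    (k := ℚ) (L := (ringClassField K ι ℓ : Type)) hfix
  refine ⟨z, ?_⟩
  have hom : Algebra.ofId ℚ (ringClassField K ι ℓ) = (algebraMap ℚ (ringClassField K ι ℓ)).toRatAlgHom :=
    AlgHom.ext fun q ↦ by simp
  have hincl : QuadraticDescent.incl (ringClassField K ι ℓ : Type) (W.quadraticTwist (((-1 : ℚ) ^ (ℓ / 2) * ℓ) * dK)) z =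
      Affine.Point.map (W' := W.quadraticTwist (((-1 : ℚ) ^ (ℓ / 2) * ℓ) * dK))
        (algebraMap ℚ (ringClassField K ι ℓ)).toRatAlgHom z :=
    congrArg (fun f : ℚ →ₐ[ℚ] ringClassField K ι ℓ ↦
      Affine.Point.map (W' := W.quadraticTwist (((-1 : ℚ) ^ (ℓ / 2) * ℓ) * dK)) f z) hom
  rw [hincl.trans hz, hΦR]

/-- **`hR0` FROM THE EVEN TWIST**: if `W^{(ℓ*·d)}(ℚ)` is finite (`√d` a generator of `K`), then on
`K[ℓ]` every `τ`-fixed `χ_ℓ`-isotypic point has finite order — the hypothesis `hR0` of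
`heegner_certificate_iff_forall_odd_not_two_dvd_in_auxField`. [cite: SilvermanAEC2009, X.2 Prop. 2.4, X.5 Cor. 5.4] -/
theorem heegner_conjFixed_isotypic_isOfFinAddOrder_of_twist {ℓ : ℕ} [hdec : DecidableEq (ringClassField K ι ℓ)]
    (hK : IsImaginaryQuadratic K) (hℓ : ℓ.Prime)
    {θ : ℕ → ringClassField K ι ℓ}
    (hθ : ∀ ℓ' ∈ ℓ.primeFactors, θ ℓ' ^ 2 = algebraMap ℚ (ringClassField K ι ℓ) ((-1 : ℚ) ^ (ℓ' / 2) * ℓ'))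
    {s₀ : K} (hs₀ : s₀ ∉ Set.range (algebraMap ℚ K)) {dK : ℚ} (hs₀2 : s₀ ^ 2 = algebraMap ℚ K dK)
    (huQ : θ ℓ * algebraMap K (ringClassField K ι ℓ) s₀ ∉ Set.range (algebraMap ℚ (ringClassField K ι ℓ)))
    (htw : Finite (W.quadraticTwist (((-1 : ℚ) ^ (ℓ / 2) * ℓ) * dK)).toAffine.Point)
    {τ : ringClassField K ι ℓ ≃ₐ[ℚ] ringClassField K ι ℓ} (hτ : τ ∉ ringClassGal ι ℓ) (hτθ : τ (θ ℓ) = -θ ℓ) :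
    ∀ S : (W.baseChange (ringClassField K ι ℓ)).toAffine.Point,
      (∀ h ∈ ringClassGal ι ℓ, pointGalHom W (ringClassField K ι ℓ) h S =
        (∏ ℓ' ∈ ℓ.primeFactors, (if h (θ ℓ') = θ ℓ' then (1 : ℤ) else -1)) • S) →
      pointGalHom W (ringClassField K ι ℓ) τ S = S → IsOfFinAddOrder S := by
  have hworld : hdec = fun a b ↦ Classical.propDecidable (a = b) := Subsingleton.elim _ _
  subst hworld
  letI hcl : DecidableEq (ringClassField K ι ℓ) := fun a b ↦ Classical.propDecidable (a = b)
  intro S hS hSτ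
  have hℓmem : ℓ ∈ ℓ.primeFactors := by rw [Nat.Prime.primeFactors hℓ]; exact Finset.mem_singleton_self ℓ
  have hu := heegner_theta_mul_sqrt_sq hθ hℓmem hs₀2
  -- every multiple `k • S` is again `τ`-fixed and isotypic, hence the transport of a `ℚ`-point of the twist
  have hmult : ∀ k : ℕ, ∃ z : (W.quadraticTwist (((-1 : ℚ) ^ (ℓ / 2) * ℓ) * dK)).toAffine.Point,
      twistPointEquivOver W huQ hu
        (QuadraticDescent.incl (ringClassField K ι ℓ : Type)
          (W.quadraticTwist (((-1 : ℚ) ^ (ℓ / 2) * ℓ) * dK)) z) = k • S := fun k ↦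
    heegner_conjFixed_isotypic_eq_twistPoint hK hℓ hθ hs₀ hs₀2 huQ hu hτ hτθ
      (fun h hh ↦ by rw [map_nsmul, hS h hh, smul_comm]) (by rw [map_nsmul, hSτ])
  choose zk hzk using hmult
  -- the twist has finitely many `ℚ`-points: two multiples coincide (pigeonhole), so `S` has finite order
  haveI := htw
  obtain ⟨i, j, hij, hz⟩ := Finite.exists_ne_map_eq_of_infinite zk
  have hijS : (i : ℤ) • S = (j : ℤ) • S := by
    rw [natCast_zsmul, natCast_zsmul, ← hzk i, ← hzk j, hz]
  refine (isOfFinAddOrder_iff_zsmul_eq_zero).mpr ⟨(i : ℤ) - (j : ℤ), ?_, ?_⟩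
  · exact sub_ne_zero.mpr (by exact_mod_cast hij)
  · rw [sub_zsmul, hijS]
    abel

end Descent

/-! ### §3 The auxiliary-field certificate with the rank hypothesis on the even twist only -/

section Certificate

variable {W : WeierstrassCurve ℚ} [NeZero (W.conductorNorm ℤ)] {K : Type} [Field K] [NumberField K]
  {Dt : ModularParametrizationData W (W.conductorNorm ℤ)} {β : ℤ} {ι : K →+* ℂ}


/-- **THE CERTIFICATE IN THE AUXILIARY FIELD, `τ`-FREE FORM.** On the crux's frame at a depth-2 Kolyvagin prime `ℓ` (`4 ∣ a_ℓ`)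
with `W_ℓ` the reduced genus point: IF the even genus twist `W^{(ℓ*·d_K)}` (for ANY square root `√d_K` of a rational
non-square generating `K`, e.g. the field discriminant) has FINITELY many `ℚ`-points (rank `0`), THEN the crux's certificate clause holds
iff NO odd multiple of `W_ℓ` is twice a `ℚ(θ_ℓ)`-rational point of `E(K[ℓ])`. (`τ` is produced internally by
`heegner_exists_not_mem_ringClassGal_apply_theta_eq_neg`.) [cite: GrossLMS1991, §3 (3.5), §4 (4.1), Lemma 4.3, §5]
[cite: Cox2013, §9.A Lemma 9.3] [cite: SilvermanAEC2009, X.2 Prop. 2.4, X.5 Cor. 5.4] -/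
theorem heegner_certificate_iff_auxField_of_evenTwist_torsion [W.IsElliptic] [W.IsGloballyMinimal]
    (hK : IsImaginaryQuadratic K) (hodd : Odd (NumberField.discr K)) (h3 : NumberField.discr K ≠ -3)
    (hH : SatisfiesHeegnerHypothesis (W.conductorNorm ℤ) K) (hsurj : W.HasSurjectiveModNGaloisRep ((2 : ℤ) ^ 1))
    {ℓ : ℕ} (hℓ : ℓ.Prime) (hKoly : ∀ ℓ' ∈ ℓ.primeFactors, Zhang2014.IsKolyvaginPrime (W.conductorNorm ℤ) W K 2 ℓ')
    (hfour : ∀ ℓ' ∈ ℓ.primeFactors, (4 : ℤ) ∣ W.frobeniusTrace ℓ')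
    (d : KolyvaginHeegnerData Dt β ι ℓ) {θ : ℕ → ringClassField K ι ℓ}
    (hθ : ∀ ℓ' ∈ ℓ.primeFactors, θ ℓ' ^ 2 = algebraMap ℚ (ringClassField K ι ℓ) ((-1 : ℚ) ^ (ℓ' / 2) * ℓ'))
    (G : Finset (ringClassField K ι ℓ ≃ₐ[ℚ] ringClassField K ι ℓ)) (hG : ∀ g, g ∈ G ↔ g ∈ ringClassGal ι ℓ)
    (T : Finset (ringClassField K ι ℓ ≃ₐ[ℚ] ringClassField K ι ℓ))
    (hT : ∀ g, g ∈ T ↔ g ∈ ringClassGal ι ℓ ∧ ∀ ℓ' ∈ ℓ.primeFactors, g (θ ℓ') = θ ℓ')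
    {s₀ : K} (hs₀ : s₀ ∉ Set.range (algebraMap ℚ K)) {dK : ℚ} (hs₀2 : s₀ ^ 2 = algebraMap ℚ K dK)
    (htw : Finite (W.quadraticTwist (((-1 : ℚ) ^ (ℓ / 2) * ℓ) * dK)).toAffine.Point)
    {Wn : (W.baseChange (ringClassField K ι ℓ)).toAffine.Point}
    (hWn : ((2 : ℤ) ^ ℓ.primeFactors.card) • Wn =
      ∑ g ∈ G, (∏ ℓ' ∈ ℓ.primeFactors, (if g (θ ℓ') = θ ℓ' then (1 : ℤ) else -1)) •
        pointGalHom W (ringClassField K ι ℓ) g d.y) :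
    (¬ ∃ Q : (W.baseChange (ringClassField K ι ℓ)).toAffine.Point, (2 : ℤ) • Q =
        ∑ g ∈ T, pointGalHom W (ringClassField K ι ℓ) g d.y) ↔
      ∀ m : ℕ, Odd m → ¬ ∃ Q : (W.baseChange (ringClassField K ι ℓ)).toAffine.Point,
        (∀ g : ringClassField K ι ℓ ≃ₐ[ℚ] ringClassField K ι ℓ, g (θ ℓ) = θ ℓ →
          pointGalHom W (ringClassField K ι ℓ) g Q = Q) ∧ (2 : ℤ) • Q = (m : ℤ) • Wn := by
  obtain ⟨τ, hτ, hτθ⟩ := heegner_exists_not_mem_ringClassGal_apply_theta_eq_neg hK hℓ hKoly d hθ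
  have huQ := heegner_theta_mul_sqrt_not_mem_range hK hℓ hKoly d hθ hs₀ (s₀ := s₀)
  exact heegner_certificate_iff_forall_odd_not_two_dvd_in_auxField hK hodd h3 hH hsurj hℓ hKoly hfour d hθ G hG T hT
    hτ hτθ (heegner_conjFixed_isotypic_isOfFinAddOrder_of_twist hK hℓ hθ hs₀ hs₀2 huQ htw hτ hτθ) hWn

/-- **A curve has finitely many `ℚ`-points once some elliptic model of it has `#Sel₂ = 1`** (descent count
`#Sel₂ = 2^{rank}·#E(ℚ)[2]·#Ш[2]`, Silverman X.4.2 ⟹ rank `0` ⟹ `E(ℚ)` finite, Mordell–Weil VIII.6.7 —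
`finite_point_of_rank_zero` — transported along the variable change `C`). [cite: SilvermanAEC2009, Thm. X.4.2 and Thm. VIII.6.7] -/
theorem finite_point_of_card_selmerGroup_two_eq_one (V : WeierstrassCurve ℚ) (Wd : WeierstrassCurve ℚ)
    [Wd.IsElliptic] (hC : ∃ C : WeierstrassCurve.VariableChange ℚ, C • V = Wd)
    (hSel : Nat.card (Wd.selmerGroup 2) = 1) : Finite V.toAffine.Point := by
  obtain ⟨C, rfl⟩ := hC
  have hcard := (C • V).natCard_selmerGroup_eq (n := 2) two_ne_zero
  simp only [Nat.cast_ofNat] at hcard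
  rw [hSel, mul_assoc] at hcard
  have hdvd : 2 ^ (C • V).mordellWeilRank ∣ 2 ^ 0 := by
    rw [pow_zero]
    exact Dvd.intro _ hcard.symm
  have hr : (C • V).mordellWeilRank = 0 :=
    Nat.le_zero.mp ((Nat.pow_dvd_pow_iff_le_right one_lt_two).mp hdvd)
  haveI : Finite (C • V).toAffine.Point := finite_point_of_rank_zero (C • V) hr
  exact Finite.of_equiv _ (VariableChange.pointEquiv V C).toEquiv.symm

/-- **THE CERTIFICATE IN THE AUXILIARY FIELD ON THE SELMER-MINIMAL GENUS PAIR (rank-0 side).** On the crux's frame at a depth-2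
Kolyvagin prime `ℓ`: if SOME elliptic model `Wd` of the even genus twist `W^{(ℓ*·d_K)}` (`√d_K ∈ K` ANY square root of a
rational non-square) has `#Sel₂(Wd) = 1`, then the certificate clause `Σ_{g∈T} g·y(ℓ) ∉ 2E(K[ℓ])` holds **iff no odd
multiple of the reduced genus point `W_ℓ` is twice a `ℚ(θ_ℓ)`-rational point of `E(K[ℓ])`** — U(ℓ) as a statement inside
`E(ℚ(√ℓ*)) ⊗ ℤ₂`, with the only extra input a 2-DESCENT count on the even genus twist (the LEVEL LAW's minimal pair).
[cite: GrossLMS1991, §3 (3.5), §4 (4.1), Lemma 4.3, §5] [cite: SilvermanAEC2009, X.2 Prop. 2.4, X.4.2, VIII.6.7] -/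
theorem heegner_certificate_iff_auxField_of_card_selmerGroup_evenTwist_eq_one [W.IsElliptic] [W.IsGloballyMinimal]
    (hK : IsImaginaryQuadratic K) (hodd : Odd (NumberField.discr K)) (h3 : NumberField.discr K ≠ -3)
    (hH : SatisfiesHeegnerHypothesis (W.conductorNorm ℤ) K) (hsurj : W.HasSurjectiveModNGaloisRep ((2 : ℤ) ^ 1))
    {ℓ : ℕ} (hℓ : ℓ.Prime) (hKoly : ∀ ℓ' ∈ ℓ.primeFactors, Zhang2014.IsKolyvaginPrime (W.conductorNorm ℤ) W K 2 ℓ')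
    (hfour : ∀ ℓ' ∈ ℓ.primeFactors, (4 : ℤ) ∣ W.frobeniusTrace ℓ')
    (d : KolyvaginHeegnerData Dt β ι ℓ) {θ : ℕ → ringClassField K ι ℓ}
    (hθ : ∀ ℓ' ∈ ℓ.primeFactors, θ ℓ' ^ 2 = algebraMap ℚ (ringClassField K ι ℓ) ((-1 : ℚ) ^ (ℓ' / 2) * ℓ'))
    (G : Finset (ringClassField K ι ℓ ≃ₐ[ℚ] ringClassField K ι ℓ)) (hG : ∀ g, g ∈ G ↔ g ∈ ringClassGal ι ℓ)
    (T : Finset (ringClassField K ι ℓ ≃ₐ[ℚ] ringClassField K ι ℓ))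
    (hT : ∀ g, g ∈ T ↔ g ∈ ringClassGal ι ℓ ∧ ∀ ℓ' ∈ ℓ.primeFactors, g (θ ℓ') = θ ℓ')
    {s₀ : K} (hs₀ : s₀ ∉ Set.range (algebraMap ℚ K)) {dK : ℚ} (hs₀2 : s₀ ^ 2 = algebraMap ℚ K dK)
    (Wd : WeierstrassCurve ℚ) [Wd.IsElliptic]
    (hC : ∃ C : WeierstrassCurve.VariableChange ℚ, C • W.quadraticTwist (((-1 : ℚ) ^ (ℓ / 2) * ℓ) * dK) = Wd)
    (hSel : Nat.card (Wd.selmerGroup 2) = 1)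
    {Wn : (W.baseChange (ringClassField K ι ℓ)).toAffine.Point}
    (hWn : ((2 : ℤ) ^ ℓ.primeFactors.card) • Wn =
      ∑ g ∈ G, (∏ ℓ' ∈ ℓ.primeFactors, (if g (θ ℓ') = θ ℓ' then (1 : ℤ) else -1)) •
        pointGalHom W (ringClassField K ι ℓ) g d.y) :
    (¬ ∃ Q : (W.baseChange (ringClassField K ι ℓ)).toAffine.Point, (2 : ℤ) • Q =
        ∑ g ∈ T, pointGalHom W (ringClassField K ι ℓ) g d.y) ↔
      ∀ m : ℕ, Odd m → ¬ ∃ Q : (W.baseChange (ringClassField K ι ℓ)).toAffine.Point,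
        (∀ g : ringClassField K ι ℓ ≃ₐ[ℚ] ringClassField K ι ℓ, g (θ ℓ) = θ ℓ →
          pointGalHom W (ringClassField K ι ℓ) g Q = Q) ∧ (2 : ℤ) • Q = (m : ℤ) • Wn :=
  heegner_certificate_iff_auxField_of_evenTwist_torsion hK hodd h3 hH hsurj hℓ hKoly hfour d hθ G hG T hT hs₀ hs₀2
    (finite_point_of_card_selmerGroup_two_eq_one _ Wd hC hSel) hWn

/-- **A square root of the field discriminant is available as `√d`** (so `dK = d_K` above): `K` quadratic ⟹
`∃ δ ∈ K ∖ ℚ` with `δ² = d_K`. Restates the tree's `Quadratic.exists_not_mem_range_sq_eq_discr` on the crux's frame. [folklore] -/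
theorem heegner_exists_sqrt_discr (hK : IsImaginaryQuadratic K) :
    ∃ s₀ : K, s₀ ∉ Set.range (algebraMap ℚ K) ∧ s₀ ^ 2 = algebraMap ℚ K (NumberField.discr K : ℚ) :=
  Quadratic.exists_not_mem_range_sq_eq_discr hK.1

end Certificate

end Summit.BirchSwinnertonDyer.BirchSwinnertonDyer.Theorems.GenusKoly

end
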